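import Summits.Ventures.Crystal3D.Theorems.StickyWulffConstantGenericWallFloorChainLedgerAntipodal
import HarnessLib

/-!
# `DoubleStarFree`: the named geometric input that removes the double-top residual of the chain
# ledger for EVERY pair of steep walk slots (crux `GenericWallFloor`, line `WallLedgerG`)

HONEST FRAMING. Part of the venture `Summits/Ventures/Crystal3D` (cell `crystal3d-full`), helper
`--supports` the crux `GenericWallFloor` (stmt-Ventures-19480) of `route-Ventures-StickyWulffConstant`,
registered line `WallLedgerG`, open stub `stub_twoSlabAdhesion`.  Sequel of `…ChainLedgerAntipodal`.
The chain ledger `twoSlabAdhesion_chainLedger'` has the residual `#DT₁₁` (coincidence-site double tops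
of degree exactly `11`).  This file NAMES the finite-dimensional geometric statement that kills it, in the
cell's style for computational inputs (like `KissingGap δ`, `KissingClassification δ`, `ExactOnly`):

* `DoubleStarFree` (Prop): in a `1`-separated configuration, a ball `e` that is an exit of a frame `A₁`
  upward along a steep slot `u₁` AND of a frame `A₂` downward along a steep slot `u₂` (both
  predecessors `e − Aᵢ uᵢ` carry full slot shells), with `A₁·Λ₀ ≠ A₂·Λ₀`, never has EXACTLY eleven
  contacts.  Evidence: planner cf-p1 g24's double-star census (kit j292323: two closed vertex stars of
  non-co-axial frames + an 11th unit vector pairwise `≥ 60°` is infeasible; the sup of the free angle is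
  `60°` only in the Σ3-twin = co-axial limit), proposed certificate R39d (local first-order rigidity at
  the twin configuration + interval B&B over `SO(3)`, HOME INBOX 2026-08-27 23:2xZ).  NOT a theorem here.
* `doubleStarFree_antipodal` — the ANTIPODAL instances (`A₁ u₁ + A₂ u₂ = 0`) of `DoubleStarFree` ARE a
  theorem (`card_neighbours_le_ten_of_antipodal_stars`, …StarLemma): the sanity anchor of the Prop.
* **`twoSlabAdhesion_chainLedger_of_doubleStarFree`** — under `DoubleStarFree` (and the E1 row
  `ExactOnly`(C12-55)) the general-filling wall floor holds for EVERY choice of steep slots at full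
  charge `½(κ₁ + κ₂) ≥ 1` modulo ONLY the twin-capped lattice exits `#TC₁ + #TC₂`.

WHAT THIS IS NOT: `DoubleStarFree` is an INPUT (certified computation pending), not proved; not the stub;
F-C1 not moved.
-/

noncomputable section

namespace Summit.Ventures.Crystal3D.Theorems

open Summit.Ventures.Crystal3D Finset
open Literature.MathematicalPhysics.StatisticalMechanics (fccStacking contactDeficiency)
open scoped InnerProductSpace

/-- **`DoubleStarFree`** (geometric input of the chain ledger, census kit j292323, certificate R39d
pending): in a `1`-separated configuration `X`, a ball `e` whose `A₁ u₁`-predecessor and `A₂ u₂`-predecessor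
both carry FULL slot shells — `u₁` steep up for the frame `A₁`, `u₂` steep down for the frame `A₂`, the two
linear lattices different — does not have exactly eleven contacts. -/
def DoubleStarFree : Prop :=
  ∀ (A₁ A₂ : EuclideanSpace ℝ (Fin 3) ≃ₗᵢ[ℝ] EuclideanSpace ℝ (Fin 3)),
    A₁ '' fccStacking 1 (Real.sqrt (2 / 3)) ≠ A₂ '' fccStacking 1 (Real.sqrt (2 / 3)) →
    ∀ u₁ ∈ fccSlots, ∀ u₂ ∈ fccSlots,
      Real.sqrt 2 / 2 ≤ ⟪A₁ u₁, EuclideanSpace.single (2 : Fin 3) (1 : ℝ)⟫_ℝ →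
      ⟪A₂ u₂, EuclideanSpace.single (2 : Fin 3) (1 : ℝ)⟫_ℝ ≤ -(Real.sqrt 2 / 2) →
      ∀ (X : Finset (EuclideanSpace ℝ (Fin 3))), (∀ p ∈ X, ∀ q ∈ X, p ≠ q → 1 ≤ dist p q) →
        ∀ e ∈ X, e - A₁ u₁ ∈ X → (∀ w ∈ fccSlots, e - A₁ u₁ + A₁ w ∈ X) →
          e - A₂ u₂ ∈ X → (∀ w ∈ fccSlots, e - A₂ u₂ + A₂ w ∈ X) →
          (X.filter fun q => dist e q = 1).card ≠ 11

/-- **The antipodal instances of `DoubleStarFree` hold** (star lemma): with `A₁ u₁ + A₂ u₂ = 0` such a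
ball has at most ten contacts. -/
theorem doubleStarFree_antipodal (A₁ A₂ : EuclideanSpace ℝ (Fin 3) ≃ₗᵢ[ℝ] EuclideanSpace ℝ (Fin 3))
    (hne : A₁ '' fccStacking 1 (Real.sqrt (2 / 3)) ≠ A₂ '' fccStacking 1 (Real.sqrt (2 / 3)))
    {u₁ u₂ : EuclideanSpace ℝ (Fin 3)} (hu₁ : u₁ ∈ fccSlots) (hu₂ : u₂ ∈ fccSlots)
    (hanti : A₁ u₁ + A₂ u₂ = 0) {X : Finset (EuclideanSpace ℝ (Fin 3))}
    (hX : ∀ p ∈ X, ∀ q ∈ X, p ≠ q → 1 ≤ dist p q) {e : EuclideanSpace ℝ (Fin 3)}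
    (hd₁ : e - A₁ u₁ ∈ X) (hf₁ : ∀ w ∈ fccSlots, e - A₁ u₁ + A₁ w ∈ X)
    (hd₂ : e - A₂ u₂ ∈ X) (hf₂ : ∀ w ∈ fccSlots, e - A₂ u₂ + A₂ w ∈ X) :
    (X.filter fun q => dist e q = 1).card ≠ 11 := by
  classical
  have h10 := card_neighbours_le_ten_of_antipodal_stars hX A₁ A₂ hne hu₁ hu₂ hanti
    (fun s hs hsu => exit_owns_closedStar A₁ hu₁ hd₁ hf₁ hs (by rwa [LinearIsometryEquiv.inner_map_map]))
    (fun s hs hsu => exit_owns_closedStar A₂ hu₂ hd₂ hf₂ hs (by rwa [LinearIsometryEquiv.inner_map_map]))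
  omega

open scoped Classical in
/-- **The chain ledger modulo `DoubleStarFree`: no double-top residual for ANY steep slots.** -/
theorem twoSlabAdhesion_chainLedger_of_doubleStarFree (hDS : DoubleStarFree)
    {s₀ : EuclideanSpace ℝ (Fin 3)} (hs₀ : s₀ ∈ fccSlots)
    (hcert : ExactOnly 0 (fccSlots.filter fun w => 0 < ⟪w, s₀⟫_ℝ))
    (A₁ : EuclideanSpace ℝ (Fin 3) ≃ₗᵢ[ℝ] EuclideanSpace ℝ (Fin 3)) (t₁ : EuclideanSpace ℝ (Fin 3))
    (A₂ : EuclideanSpace ℝ (Fin 3) ≃ₗᵢ[ℝ] EuclideanSpace ℝ (Fin 3)) (t₂ : EuclideanSpace ℝ (Fin 3))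
    (hA₁₂ : ¬ ∀ w ∈ fccSlots, A₁ w ∈ A₂ '' fccStacking 1 (Real.sqrt (2 / 3)))
    (hA₂₁ : ¬ ∀ w ∈ fccSlots, A₂ w ∈ A₁ '' fccStacking 1 (Real.sqrt (2 / 3)))
    {u₁ : EuclideanSpace ℝ (Fin 3)} (hu₁ : u₁ ∈ fccSlots)
    (hsteep₁ : Real.sqrt 2 / 2 ≤ ⟪A₁ u₁, EuclideanSpace.single (2 : Fin 3) (1 : ℝ)⟫_ℝ)
    {u₂ : EuclideanSpace ℝ (Fin 3)} (hu₂ : u₂ ∈ fccSlots)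
    (hsteep₂ : ⟪A₂ u₂, EuclideanSpace.single (2 : Fin 3) (1 : ℝ)⟫_ℝ ≤ -(Real.sqrt 2 / 2)) :
    ∃ C R₀ : ℝ, 1 ≤ R₀ ∧ ∀ h : ℝ, 0 ≤ h → ∀ ρ : ℝ, R₀ ≤ ρ →
      ∀ X P₁ P₂ : Finset (EuclideanSpace ℝ (Fin 3)),
      (∀ p ∈ X, ∀ q ∈ X, p ≠ q → 1 ≤ dist p q) → P₁ ⊆ X → P₂ ⊆ X \ P₁ →
      (∀ p ∈ X, -(2 * R₀) ≤ p 2 ∧ p 2 ≤ h + 2 * R₀ ∧ p 0 ^ 2 + p 1 ^ 2 ≤ ρ ^ 2) →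
      (∀ p, p ∈ P₁ ↔ (p ∈ (fun q => A₁ q + t₁) '' fccStacking 1 (Real.sqrt (2 / 3)) ∧
        -(2 * R₀) ≤ p 2 ∧ p 2 ≤ -R₀ ∧ p 0 ^ 2 + p 1 ^ 2 ≤ ρ ^ 2)) →
      (∀ p, p ∈ P₂ ↔ (p ∈ (fun q => A₂ q + t₂) '' fccStacking 1 (Real.sqrt (2 / 3)) ∧
        h + R₀ ≤ p 2 ∧ p 2 ≤ h + 2 * R₀ ∧ p 0 ^ 2 + p 1 ^ 2 ≤ ρ ^ 2)) →
      -- CLEAN outer slivers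
      (∀ p ∈ X, p 2 < -(2 * R₀) + 1 → p ∈ (fun q => A₁ q + t₁) '' fccStacking 1 (Real.sqrt (2 / 3))) →
      (∀ p ∈ X, h + 2 * R₀ - 1 < p 2 → p ∈ (fun q => A₂ q + t₂) '' fccStacking 1 (Real.sqrt (2 / 3))) →
      ((((P₁ ×ˢ (X \ P₁)).filter fun pq => dist pq.1 pq.2 = 1).card : ℕ) : ℝ) +
        ((((P₂ ×ˢ ((X \ P₁) \ P₂)).filter fun pq => dist pq.1 pq.2 = 1).card : ℕ) : ℝ) ≤
        contactDeficiency ((X \ P₁) \ P₂) +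
          (Real.sqrt 2 / 4 * ∑ᶠ w ∈ {w ∈ fccStacking 1 (Real.sqrt (2 / 3)) | ‖w‖ = 1},
              |⟪w, A₁.symm (EuclideanSpace.single (2 : Fin 3) (1 : ℝ))⟫_ℝ| +
            Real.sqrt 2 / 4 * ∑ᶠ w ∈ {w ∈ fccStacking 1 (Real.sqrt (2 / 3)) | ‖w‖ = 1},
              |⟪w, A₂.symm (EuclideanSpace.single (2 : Fin 3) (1 : ℝ))⟫_ℝ| -
            (Real.sqrt 2 * |⟪A₁ u₁, EuclideanSpace.single (2 : Fin 3) (1 : ℝ)⟫_ℝ| +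
              Real.sqrt 2 * |⟪A₂ u₂, EuclideanSpace.single (2 : Fin 3) (1 : ℝ)⟫_ℝ|) / 2) * Real.pi * ρ ^ 2 +
          (((((X.filter fun e => e ∈ (fun q => A₁ q + t₁) '' fccStacking 1 (Real.sqrt (2 / 3)) ∧
                e - A₁ u₁ ∈ X ∧ (∀ w ∈ fccSlots, e - A₁ u₁ + A₁ w ∈ X) ∧
                ∃ v ∈ fccSlots, e + A₁ v ∉ X).filter fun e => ∃ n : EuclideanSpace ℝ (Fin 3), ‖n‖ = 1 ∧
              (∀ w ∈ fccSlots, ⟪A₁ w, n⟫_ℝ = 0 ∨ ⟪A₁ w, n⟫_ℝ = Real.sqrt (2 / 3) ∨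
                ⟪A₁ w, n⟫_ℝ = -Real.sqrt (2 / 3)) ∧
              ⟪A₁ u₁, n⟫_ℝ = Real.sqrt (2 / 3) ∧
              (∀ w ∈ fccSlots, ⟪A₁ w, n⟫_ℝ ≤ 0 → e + A₁ w ∈ X) ∧
              (∀ w ∈ fccSlots, 0 < ⟪A₁ w, n⟫_ℝ → e + A₁ w ∉ X ∧ e - A₁ w + (2 * ⟪A₁ w, n⟫_ℝ) • n ∈ X)).card
              : ℕ) : ℝ) +
           ((((X.filter fun e => e ∈ (fun q => A₂ q + t₂) '' fccStacking 1 (Real.sqrt (2 / 3)) ∧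
                e - A₂ u₂ ∈ X ∧ (∀ w ∈ fccSlots, e - A₂ u₂ + A₂ w ∈ X) ∧
                ∃ v ∈ fccSlots, e + A₂ v ∉ X).filter fun e => ∃ n : EuclideanSpace ℝ (Fin 3), ‖n‖ = 1 ∧
              (∀ w ∈ fccSlots, ⟪A₂ w, n⟫_ℝ = 0 ∨ ⟪A₂ w, n⟫_ℝ = Real.sqrt (2 / 3) ∨
                ⟪A₂ w, n⟫_ℝ = -Real.sqrt (2 / 3)) ∧
              ⟪A₂ u₂, n⟫_ℝ = Real.sqrt (2 / 3) ∧
              (∀ w ∈ fccSlots, ⟪A₂ w, n⟫_ℝ ≤ 0 → e + A₂ w ∈ X) ∧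
              (∀ w ∈ fccSlots, 0 < ⟪A₂ w, n⟫_ℝ → e + A₂ w ∉ X ∧ e - A₂ w + (2 * ⟪A₂ w, n⟫_ℝ) • n ∈ X)).card
              : ℕ) : ℝ)) / 2 +
          C * (1 + h) * ρ := by
  classical
  obtain ⟨C, R₀, hR₀, H⟩ := twoSlabAdhesion_chainLedger' hs₀ hcert A₁ t₁ A₂ t₂ hA₁₂ hA₂₁ hu₁ hsteep₁ hu₂ hsteep₂
  refine ⟨C, R₀, hR₀, ?_⟩
  intro h hh ρ hρ X P₁ P₂ hX hP₁X hP₂X hcell hP₁ hP₂ hclean₁ hclean₂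
  have key := H h hh ρ hρ X P₁ P₂ hX hP₁X hP₂X hcell hP₁ hP₂ hclean₁ hclean₂
  have hne : A₁ '' fccStacking 1 (Real.sqrt (2 / 3)) ≠ A₂ '' fccStacking 1 (Real.sqrt (2 / 3)) := by
    intro heq
    exact hA₁₂ fun w hw => heq ▸ ⟨w, mem_fcc_of_mem_fccSlots hw, rfl⟩
  have hempty : (X.filter fun e => e ∈ (fun q => A₁ q + t₁) '' fccStacking 1 (Real.sqrt (2 / 3)) ∧
      e ∈ (fun q => A₂ q + t₂) '' fccStacking 1 (Real.sqrt (2 / 3)) ∧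
      (X.filter fun q => dist e q = 1).card = 11 ∧
      (e - A₁ u₁ ∈ X ∧ (∀ w ∈ fccSlots, e - A₁ u₁ + A₁ w ∈ X) ∧ ∃ v ∈ fccSlots, e + A₁ v ∉ X) ∧
      (e - A₂ u₂ ∈ X ∧ (∀ w ∈ fccSlots, e - A₂ u₂ + A₂ w ∈ X) ∧ ∃ v ∈ fccSlots, e + A₂ v ∉ X)).card = 0 := by
    rw [Finset.card_eq_zero, Finset.eq_empty_iff_forall_notMem]
    intro e he
    obtain ⟨heX, -, -, h11, ⟨hd₁, hf₁, -⟩, ⟨hd₂, hf₂, -⟩⟩ := mem_filter.1 he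
    exact hDS A₁ A₂ hne u₁ hu₁ u₂ hu₂ hsteep₁ hsteep₂ X hX e heX hd₁ hf₁ hd₂ hf₂ h11
  rw [hempty] at key
  simpa using key

end Summit.Ventures.Crystal3D.Theorems

end
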